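import Summits.CriticalPhenomena.PercolationContinuityZ3.Theorems.PercNearOneGluingNoHeavyLowerTailSahiOneStepProfileGridOrStepPrelim
import Summits.CriticalPhenomena.PercolationContinuityZ3.Theorems.PercNearOneGluingNoHeavyLowerTailSahiOneStepProfileGridOrStepFibre
import HarnessLib

/-!
# THE OR-CYLINDER STEP for `(2′)` on a product of `PF₂` chains — fibre atoms (third preliminary file)

Prover prim-ineq-prove-3 gen 45 (`--supports stmt-CriticalPhenomena-4575`; memo
`run/shared/lean/prim/prim-ineq-prove-3/PROOF-G45-CHAIN-RULE.md` §5).  Fibre atoms along the cut coordinate `i`: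
factorisation `Σ_{v_i = y} Φ·g = φ_i(y)·R(g)` for `i`-invariant `g` (`fibre_factor`), the general transport form (`fibre_factor_update`),
the three pairwise monotonicities used by `orStep_M1_fibre` / `orStep_M2_fibre` (`fibre_monZ`, `fibre_monA`, `fibre_monK`), the
decomposition of a grid sum restricted by a predicate on `v_i` into fibres (`sum_fibre_filter`), and the point / low restrictions of
the product weight inside `ite`-sums.  No definitions, no sorries.
-/

noncomputable section

namespace Summit.CriticalPhenomena.PercolationContinuityZ3.Theorems

namespace SahiOneStep

namespace ProfileGrid

open Finset Function
open Literature.Probability.Distributions (IsLogConcaveSeq piWeight blockSum)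
open scoped Classical

variable {κ : Type*} [Fintype κ] [DecidableEq κ] {N : ℕ}

/-! ## Fibre sums as `φ_i(y) ×` rest -/

/-- **Transport form of a fibre sum**: `Σ_{v_i = y} F(v) = Σ_{v_i = 0} F(v with v_i := y)`. [folklore] -/
theorem fibre_factor_update (i : κ) (F : (κ → Fin (N + 1)) → ℝ) {y : ℕ} (hy : y ≤ N) :
    (∑ v : κ → Fin (N + 1), if (v i : ℕ) = y then F v else 0) =
      ∑ v : κ → Fin (N + 1), if (v i : ℕ) = 0 then F (update v i ⟨y, Nat.lt_succ_of_le hy⟩) else 0 := by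
  have h := fibre_sum_transport i F (⟨0, Nat.succ_pos N⟩ : Fin (N + 1)) ⟨y, Nat.lt_succ_of_le hy⟩
  have e1 : (∑ v : κ → Fin (N + 1), if v i = (⟨y, Nat.lt_succ_of_le hy⟩ : Fin (N + 1)) then F v else 0) =
      ∑ v : κ → Fin (N + 1), if (v i : ℕ) = y then F v else 0 :=
    sum_congr rfl fun v _ => by
      by_cases hv : (v i : ℕ) = y
      · rw [if_pos (Fin.ext hv), if_pos hv]
      · rw [if_neg (fun h' => hv (by rw [h'])), if_neg hv]
  have e0 : (∑ v : κ → Fin (N + 1), if v i = (⟨0, Nat.succ_pos N⟩ : Fin (N + 1)) then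
        F (update v i ⟨y, Nat.lt_succ_of_le hy⟩) else 0) =
      ∑ v : κ → Fin (N + 1), if (v i : ℕ) = 0 then F (update v i ⟨y, Nat.lt_succ_of_le hy⟩) else 0 :=
    sum_congr rfl fun v _ => by
      by_cases hv : (v i : ℕ) = 0
      · rw [if_pos (Fin.ext hv), if_pos hv]
      · rw [if_neg (fun h' => hv (by rw [h'])), if_neg hv]
  rw [← e1, ← h, e0]

/-- **Fibre factorisation**: for an event/integrand `g`, `Σ_{v_i = y} Φ(v)·g(v) = φ_i(y) · Σ_{v_i = 0} (Π_{j≠i} φ_j(v_j))·g(v with v_i := y)`.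
[folklore] -/
theorem fibre_factor (φ : κ → ℕ → ℝ) (i : κ) (g : (κ → Fin (N + 1)) → ℝ) {y : ℕ} (hy : y ≤ N) :
    (∑ v : κ → Fin (N + 1), if (v i : ℕ) = y then piWeight N φ v * g v else 0) =
      φ i y * ∑ v : κ → Fin (N + 1), if (v i : ℕ) = 0 then
        (∏ j ∈ univ.erase i, φ j (v j)) * g (update v i ⟨y, Nat.lt_succ_of_le hy⟩) else 0 := by
  rw [fibre_factor_update i (fun v => piWeight N φ v * g v) hy, mul_sum]
  refine sum_congr rfl fun v _ => ?_
  by_cases hv : (v i : ℕ) = 0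
  · rw [if_pos hv, if_pos hv, piWeight_update]; ring
  · rw [if_neg hv, if_neg hv, mul_zero]

omit [DecidableEq κ] in
/-- The rest-weight is nonnegative. [folklore] -/
theorem prod_erase_nonneg {φ : κ → ℕ → ℝ} (hφ0 : ∀ j n, 0 ≤ φ j n) [DecidableEq κ] (i : κ) (v : κ → Fin (N + 1)) :
    0 ≤ ∏ j ∈ univ.erase i, φ j (v j) :=
  prod_nonneg fun j _ => hφ0 j _

/-! ## Pairwise monotonicity along the cut coordinate -/

/-- `a/z` is non-decreasing: `a_y·z_{y'} ≤ a_{y'}·z_y` for `y ≤ y'`, for the numerator restricted to an `i`-invariant event `E`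
(`a_y = u(fibre y ∩ E)`, `z_y = Φ(fibre y)`). [this work] -/
theorem fibre_monA (φ : κ → ℕ → ℝ) (hφ0 : ∀ j n, 0 ≤ φ j n) (i : κ) {u : (κ → Fin (N + 1)) → ℝ}
    (hmono : ∀ v j (x x' : Fin (N + 1)), x ≤ x' → u (update v j x) * φ j x' ≤ u (update v j x') * φ j x)
    (E : (κ → Fin (N + 1)) → Prop) (hE : ∀ v k, E (update v i k) ↔ E v) {y y' : ℕ} (hyy' : y ≤ y') (hy' : y' ≤ N) :
    (∑ v : κ → Fin (N + 1), if (v i : ℕ) = y ∧ E v then u v else 0) * (∑ v : κ → Fin (N + 1), if (v i : ℕ) = y' then piWeight N φ v else 0) ≤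
      (∑ v : κ → Fin (N + 1), if (v i : ℕ) = y' ∧ E v then u v else 0) * (∑ v : κ → Fin (N + 1), if (v i : ℕ) = y then piWeight N φ v else 0) := by
  have hy : y ≤ N := hyy'.trans hy'
  -- `z_y = φ_i(y)·R`, `z_{y'} = φ_i(y')·R`
  have hz := fun (yy : ℕ) (hyy : yy ≤ N) => fibre_factor φ i (fun _ => (1 : ℝ)) (y := yy) hyy
  have ez : ∀ yy : ℕ, (∑ v : κ → Fin (N + 1), if (v i : ℕ) = yy then piWeight N φ v * (fun _ => (1 : ℝ)) v else 0) =
      ∑ v : κ → Fin (N + 1), if (v i : ℕ) = yy then piWeight N φ v else 0 :=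
    fun yy => sum_congr rfl fun v _ => by split_ifs <;> simp
  set R : ℝ := ∑ v : κ → Fin (N + 1), if (v i : ℕ) = 0 then
      (∏ j ∈ univ.erase i, φ j (v j)) * (fun _ => (1 : ℝ)) (update v i ⟨y, Nat.lt_succ_of_le hy⟩) else 0 with hR
  have hR0 : 0 ≤ R := sum_nonneg fun v _ => by
    split_ifs
    · exact mul_nonneg (prod_erase_nonneg hφ0 i v) zero_le_one
    · exact le_rfl
  rw [← ez y, ← ez y', hz y hy, hz y' hy']
  -- cross-fibre inequality for the numerator: `φ_i(y')·a_y ≤ φ_i(y)·a_{y'}`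
  have hg0 : ∀ v, 0 ≤ (if E v then (1 : ℝ) else 0) := fun v => by split_ifs <;> norm_num
  have hgE : ∀ v k, (if E (update v i k) then (1 : ℝ) else 0) = if E v then 1 else 0 := fun v k => by simp only [hE v k]
  have cross := fibre_cross_le φ i hmono (fun v => if E v then (1 : ℝ) else 0) hgE hg0
    (k := ⟨y, Nat.lt_succ_of_le hy⟩) (k' := ⟨y', Nat.lt_succ_of_le hy'⟩) (by exact_mod_cast hyy')
  have e : ∀ (yy : ℕ) (hyy : yy ≤ N), (∑ v : κ → Fin (N + 1), if v i = (⟨yy, Nat.lt_succ_of_le hyy⟩ : Fin (N + 1)) then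
      u v * (if E v then (1 : ℝ) else 0) else 0) = ∑ v : κ → Fin (N + 1), if (v i : ℕ) = yy ∧ E v then u v else 0 := by
    intro yy hyy
    refine sum_congr rfl fun v _ => ?_
    by_cases hv : (v i : ℕ) = yy
    · rw [if_pos (Fin.ext hv)]
      by_cases h2 : E v
      · rw [if_pos h2, if_pos ⟨hv, h2⟩, mul_one]
      · rw [if_neg h2, if_neg (fun h => h2 h.2), mul_zero]
    · rw [if_neg (fun h' => hv (by rw [h'])), if_neg (fun h => hv h.1)]
  rw [e y hy, e y' hy'] at cross
  -- `a_y · (φ y' R) ≤ a_{y'} · (φ y R)`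
  calc (∑ v : κ → Fin (N + 1), if (v i : ℕ) = y ∧ E v then u v else 0) * (φ i y' * R)
      = (φ i y' * ∑ v : κ → Fin (N + 1), if (v i : ℕ) = y ∧ E v then u v else 0) * R := by ring
    _ ≤ (φ i y * ∑ v : κ → Fin (N + 1), if (v i : ℕ) = y' ∧ E v then u v else 0) * R :=
        mul_le_mul_of_nonneg_right cross hR0
    _ = _ := by ring

/-- `l/z` is non-increasing for the slot: `l_{y'}·z_y ≤ l_y·z_{y'}` for `y ≤ y'`, `l_y = Φ(fibre y ∩ {Σ v < t})`. [this work] -/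
theorem fibre_monZ (φ : κ → ℕ → ℝ) (hφ0 : ∀ j n, 0 ≤ φ j n) (i : κ) (t : ℕ) {y y' : ℕ} (hyy' : y ≤ y') (hy' : y' ≤ N) :
    (∑ v : κ → Fin (N + 1), if (v i : ℕ) = y' ∧ ¬ t ≤ blockSum univ v then piWeight N φ v else 0) *
        (∑ v : κ → Fin (N + 1), if (v i : ℕ) = y then piWeight N φ v else 0) ≤
      (∑ v : κ → Fin (N + 1), if (v i : ℕ) = y ∧ ¬ t ≤ blockSum univ v then piWeight N φ v else 0) *
        (∑ v : κ → Fin (N + 1), if (v i : ℕ) = y' then piWeight N φ v else 0) := by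
  have hy : y ≤ N := hyy'.trans hy'
  have hz := fun (yy : ℕ) (hyy : yy ≤ N) => fibre_factor φ i (fun _ => (1 : ℝ)) (y := yy) hyy
  have hl := fun (yy : ℕ) (hyy : yy ≤ N) =>
    fibre_factor φ i (fun v => if ¬ t ≤ blockSum univ v then (1 : ℝ) else 0) (y := yy) hyy
  simp only [mul_one] at hz
  have el : ∀ (yy : ℕ), (∑ v : κ → Fin (N + 1), if (v i : ℕ) = yy then
      piWeight N φ v * (if ¬ t ≤ blockSum univ v then (1 : ℝ) else 0) else 0) =
      ∑ v : κ → Fin (N + 1), if (v i : ℕ) = yy ∧ ¬ t ≤ blockSum univ v then piWeight N φ v else 0 := by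
    intro yy
    refine sum_congr rfl fun v _ => ?_
    by_cases hv : (v i : ℕ) = yy
    · rw [if_pos hv]
      by_cases h2 : ¬ t ≤ blockSum univ v
      · rw [if_pos h2, if_pos ⟨hv, h2⟩, mul_one]
      · rw [if_neg h2, if_neg (fun h => h2 h.2), mul_zero]
    · rw [if_neg hv, if_neg (fun h => hv h.1)]
  rw [← el y, ← el y', hl y hy, hl y' hy', hz y hy, hz y' hy']
  set R : ℝ := ∑ v : κ → Fin (N + 1), if (v i : ℕ) = 0 then ∏ j ∈ univ.erase i, φ j (v j) else 0 with hR
  set RLy : ℝ := ∑ v : κ → Fin (N + 1), if (v i : ℕ) = 0 then (∏ j ∈ univ.erase i, φ j (v j)) *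
      (if ¬ t ≤ blockSum univ (update v i ⟨y, Nat.lt_succ_of_le hy⟩) then (1 : ℝ) else 0) else 0 with hRLy
  set RLy' : ℝ := ∑ v : κ → Fin (N + 1), if (v i : ℕ) = 0 then (∏ j ∈ univ.erase i, φ j (v j)) *
      (if ¬ t ≤ blockSum univ (update v i ⟨y', Nat.lt_succ_of_le hy'⟩) then (1 : ℝ) else 0) else 0 with hRLy'
  -- the two rest-sums compare: `RLy' ≤ RLy`
  have key : RLy' ≤ RLy := by
    refine sum_le_sum fun v _ => ?_
    by_cases hv : (v i : ℕ) = 0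
    · rw [if_pos hv, if_pos hv]
      refine mul_le_mul_of_nonneg_left ?_ (prod_erase_nonneg hφ0 i v)
      have hle : blockSum univ (update v i ⟨y, Nat.lt_succ_of_le hy⟩) ≤
          blockSum univ (update v i ⟨y', Nat.lt_succ_of_le hy'⟩) := by
        rw [blockSum_univ_eq_add_erase _ i, blockSum_univ_eq_add_erase (update v i ⟨y', _⟩) i, update_self, update_self,
          blockSum_erase_update, blockSum_erase_update]
        exact Nat.add_le_add_right hyy' _
      by_cases h1 : ¬ t ≤ blockSum univ (update v i ⟨y', Nat.lt_succ_of_le hy'⟩)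
      · rw [if_pos h1, if_pos (fun h => h1 (h.trans hle))]
      · rw [if_neg h1]; split_ifs <;> norm_num
    · rw [if_neg hv, if_neg hv]
  have hR0 : 0 ≤ R := sum_nonneg fun v _ => by
    split_ifs
    · exact prod_erase_nonneg hφ0 i v
    · exact le_rfl
  have h := mul_le_mul_of_nonneg_left key (mul_nonneg (mul_nonneg (hφ0 i y) (hφ0 i y')) hR0)
  calc φ i y' * RLy' * (φ i y * R) = φ i y * φ i y' * R * RLy' := by ring
    _ ≤ φ i y * φ i y' * R * RLy := h
    _ = φ i y * RLy * (φ i y' * R) := by ring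

end ProfileGrid

end SahiOneStep

end Summit.CriticalPhenomena.PercolationContinuityZ3.Theorems
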